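import Literature.NumberTheory.Irrationality.FischlerZudilin2010.OddZetaDim139
import HarnessLib

/-!
# Zudilin 2002 (Izvestiya): irrational odd zeta values in the windows `[b+2, 8b−1]`, and `δ(a) > 0.395 log a`

Topic `Literature/NumberTheory/Irrationality/Zudilin2002` (the directory also holds the files of the Mat. Zametki
recursion paper [Zudilin2002Zeta5]; THIS file types the Izvestiya paper [Zudilin2002]). Typed, cited statements (named
facts, no proofs — except Theorem 3, DERIVED here from the tree's sharper Fischler–Zudilin 2010 record), read on the page from

* W. Zudilin, *Irrationality of values of the Riemann zeta function*, Izv. Math. 66:3 (2002) 489–542 = arXiv:math/0104249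
  [Zudilin2002] (held: `paper:arxiv-math_0104249`, arXiv text; theorem numbers of the arXiv version, §2 "Main results"),
  with "`δ(a)` the dimension of the spaces spanned over `ℚ` by `1, ζ(3), ζ(5), …, ζ(a−2), ζ(a)`, where `a` is odd" (§1):

  "**Theorem 1.** Each of the following collections `{ζ(5), ζ(7), ζ(9), ζ(11), ζ(13), ζ(15), ζ(17), ζ(19), ζ(21)}`,
  `{ζ(7), ζ(9), …, ζ(35), ζ(37)}`, `{ζ(9), ζ(11), …, ζ(51), ζ(53)}` contains at least one irrational number."
  "**Theorem 2.** For each odd integer `b ≥ 1` the collection `ζ(b+2), ζ(b+4), …, ζ(8b−3), ζ(8b−1)` contains at least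
  one irrational number."
  "**Theorem 3.** There exist odd integers `a₁ ≤ 145` and `a₂ ≤ 1971` such that the numbers `1, ζ(3), ζ(a₁), ζ(a₂)` are
  linearly independent over `ℚ`."
  "**Theorem 4.** For each odd integer `a ≥ 3` there holds the absolute estimate
  `δ(a) > 0.395 log a > (2/3) · log a/(1 + log 2)`."
  (§6: Theorem 1 from the parameters `(a, b, c) = (19, 3, 3), (33, 5, 3), (47, 7, 3)`; Theorem 2 from `a = 7b`, `c = 3`.)

Context in the tree: the first collection of Theorem 1 is superseded by Zudilin 2001 "one of `ζ(5), ζ(7), ζ(9), ζ(11)`"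
(`Literature.NumberTheory.Transcendental.zudilin`, PROVED `zudilin_holds`); Theorem 3 by Fischler–Zudilin 2010, Theorem 3
(`i₁ ≤ 139`, `i₂ ≤ 1961`; tree `FischlerZudilin2010.theorem3`, from which `theorem3_of_fischlerZudilin2010` below DERIVES
Zudilin's); Theorem 4 is an ABSOLUTE (every odd `a ≥ 3`) companion of the asymptotic Ball–Rivoal bound
(`Transcendental.ball_rivoal`, PROVED) and of Lai 2024 (`Lai2024.theorem11`); Theorem 2 is the Archimedean model of Lai's
2-adic window theorem (`PAdicZetaValues.lai2025TwoAdic_theorem11`, `[s+3, 3s+5]`) and of Lai–Lupu–Sprang 2025.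

Rendering: `ζ(k) = zetaValue k`; `δ(a)` as `Module.finrank ℚ` of the span in the shape of `ball_rivoal` /
`FischlerZudilin2010.oddZetaDim139` (`insert 1 {ζ(k) : k odd, 3 ≤ k ≤ a}`).

Cell zeta5-irr / pub-zeta5 (HONEST FRAMING: systematic search; no irrationality claim unless certified): RECORD entries (the
hypergeometric window method with the saddle-point method and refined denominators); nothing here isolates `ζ(5)`.
-/

noncomputable section

namespace Literature.NumberTheory.Irrationality.Zudilin2002

open Literature.NumberTheory.Transcendental (zetaValue)

/-- `δ(a) = dim_ℚ Span_ℚ(1, ζ(3), ζ(5), …, ζ(a))` (`a` odd), in the shape of the tree's `ball_rivoal`.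
[cite: Zudilin2002, §1 (definition of `δ(a)`)] -/
def delta (a : ℕ) : ℕ :=
  Module.finrank ℚ (Submodule.span ℚ
    (insert (1 : ℝ) {x | ∃ k : ℕ, Odd k ∧ 3 ≤ k ∧ k ≤ a ∧ x = zetaValue k}))

/-- "The collection `ζ(b+2), ζ(b+4), …` of the odd zeta values `ζ(s)`, `s` odd, `lo ≤ s ≤ hi`, contains at least one
irrational number." [cite: Zudilin2002, §2 (Theorems 1–2, phrasing)] -/
def SomeIrrationalOddZeta (lo hi : ℕ) : Prop :=
  ∃ s : ℕ, Odd s ∧ lo ≤ s ∧ s ≤ hi ∧ Irrational (zetaValue s)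

/-- **Zudilin 2002 (Izv.), Theorem 1** (named fact, statement only): "Each of the following collections
`{ζ(5), ζ(7), …, ζ(21)}`, `{ζ(7), ζ(9), …, ζ(37)}`, `{ζ(9), ζ(11), …, ζ(53)}` contains at least one irrational number."
[cite: Zudilin2002, Thm 1 (arXiv:math/0104249 §2 (1))] -/
def theorem1 : Prop :=
  SomeIrrationalOddZeta 5 21 ∧ SomeIrrationalOddZeta 7 37 ∧ SomeIrrationalOddZeta 9 53

/-- **Zudilin 2002 (Izv.), Theorem 2** (named fact, statement only): "For each odd integer `b ≥ 1` the collection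
`ζ(b+2), ζ(b+4), …, ζ(8b−3), ζ(8b−1)` contains at least one irrational number." [cite: Zudilin2002, Thm 2 (arXiv:math/0104249 §2)] -/
def theorem2 : Prop :=
  ∀ b : ℕ, Odd b → SomeIrrationalOddZeta (b + 2) (8 * b - 1)

/-- **Zudilin 2002 (Izv.), Theorem 3** (named fact): "There exist odd integers `a₁ ≤ 145` and `a₂ ≤ 1971` such that the
numbers `1, ζ(3), ζ(a₁), ζ(a₂)` are linearly independent over `ℚ`." (Superseded by Fischler–Zudilin 2010, Thm 3:
`139`, `1961` — see `theorem3_of_fischlerZudilin2010`.) [cite: Zudilin2002, Thm 3 (arXiv:math/0104249 §2)] -/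
def theorem3 : Prop :=
  ∃ a₁ a₂ : ℕ, Odd a₁ ∧ Odd a₂ ∧ a₁ ≤ 145 ∧ a₂ ≤ 1971 ∧
    LinearIndependent ℚ ![(1 : ℝ), zetaValue 3, zetaValue a₁, zetaValue a₂]

/-- Zudilin's Theorem 3 follows from the tree's Fischler–Zudilin 2010 Theorem 3 (`i₁ ≤ 139 ≤ 145`, `i₂ ≤ 1961 ≤ 1971`).
[cite: Zudilin2002, Thm 3] [cite: FischlerZudilin2010, Theorem 3 (p. 742)] -/
theorem theorem3_of_fischlerZudilin2010 (h : FischlerZudilin2010.theorem3) : theorem3 := by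
  obtain ⟨i₁, i₂, h₁, h₂, h₁le, h₂le, hli⟩ := h
  exact ⟨i₁, i₂, h₁, h₂, by omega, by omega, hli⟩

/-- **Zudilin 2002 (Izv.), Theorem 4** (named fact, statement only): "For each odd integer `a ≥ 3` there holds the absolute
estimate `δ(a) > 0.395 log a > (2/3) · log a/(1 + log 2)`" (the second inequality is numerical: `(2/3)/(1 + log 2) =
0.3937…`). [cite: Zudilin2002, Thm 4 (arXiv:math/0104249 §2 (2))] -/
def theorem4 : Prop :=
  ∀ a : ℕ, Odd a → 3 ≤ a → (0.395 : ℝ) * Real.log a < (delta a : ℝ)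

end Literature.NumberTheory.Irrationality.Zudilin2002
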